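import Summits.CriticalPhenomena.PercolationContinuityZ3.Theorems.Transplant.AutChartOrbitsGoodCoordinates
import HarnessLib

/-!
# The TREE CHART of an action with finitely many orbits, I: CONNECTED TRANSVERSALS and INDEPENDENT EDGE VALUES
# (customer side of the quasi-step rung (N3-b) under the exact-footprint field `Skelφ.QStepsN`; refuter's R2′ finding F3)

builds on p205010 (kernel theorem, internal audit signed; external expert review pending) — nothing in this file uses p205010 and nothing here is a
percolation statement or a claim about any node.  Lane `prim-bschramm`, seat `prim-bschramm-p5` gen 28 (refuter / sharpness seat; P5-SHARPNESS §60.3,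
lane INBOX 2026-08-27 05:49Z / 05:58Z).  Helper file (`--supports stmt-CriticalPhenomena-4575 --as helper`); PROOFS ONLY (def-free).

WHY.  The quasi-step rung must re-type the Kozma–Nitzan kit layer under a quasi-step field.  The refuter located (P5-SHARPNESS §60.1) that the two-sided
`InHull` footprint of `Skelφ.PsiSteps` is UNSOUND at the contact layer (KN Step III, `KitOK.S_sub`), while the lane's exact-footprint currency `Skelφ.QStepsN`
(«SkelPhiQStepsN») is sound.  The TREE-CHART LEMMA (§60.3) says `QStepsN` costs no customer: every action with finitely many orbits and a rank-two
character killing the stabilisers carries a chart with EXACT-footprint quasi-steps, provided the transversal is chosen CONNECTED (a connected fundamental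
domain) and the character is re-based on two INDEPENDENT EDGE VALUES.  This file supplies exactly those two inputs; the chart itself is the sequel
«AutChartTreeChart».
* §1 **`exists_connected_transversal`**: a connected graph with an action by automorphisms having finitely many orbits has a transversal (one vertex per
  orbit, covering, pairwise inequivalent) any two of whose members are joined by a walk THROUGH REPRESENTATIVES (grow the transversal one adjacent orbit at a
  time along a boundary dart of a walk to an uncovered orbit).
* §2 **`exists_indep_adj_values`**: if a character `c : A → ℤ²` killing every stabiliser has rank-two image, then two NEIGHBOURS of representatives have
  independent zero-offset chart values (`MaxArea.det2 ≠ 0`) — otherwise every chart difference along every walk is parallel to one edge value (walk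
  induction), contradicting rank two.
[cite: BenjaminiSchramm1996, §2 (almost transitive graphs)] [cite: KozmaNitzan2024, §4 p. 16 (Lemma 8: good coordinates)] [cite: MartineauTassion2017, §3.2]
-/

noncomputable section

namespace Summit.CriticalPhenomena.PercolationContinuityZ3.Theorems.Transplant

open SimpleGraph Literature.Barriers.CriticalPhenomena Literature.Probability.LatticeModels Literature.Probability.Percolation
open scoped Classical

namespace AutChart

variable {V : Type} {G : SimpleGraph V} {A : Type} [Group A] [MulAction A V]

/-! ## §1 Connected transversals -/

section Transversal

variable (hact : IsActionByAut G A)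
include hact

/-- One growth step: a pairwise-inequivalent, walk-connected, nonempty set of representatives that misses the orbit of some vertex can be enlarged by ONE
vertex adjacent to a member, keeping both properties, so that a previously uncovered vertex of a given covering family becomes covered.
[cite: BenjaminiSchramm1996, §2 (almost transitive graphs)] -/
theorem exists_insert_transversal (hc : G.Connected) {S : Finset V} (hne : S.Nonempty)
    (htrans : ∀ r ∈ S, ∀ r' ∈ S, ∀ a : A, a • r = r' → r = r')
    (hconn : ∀ r ∈ S, ∀ r' ∈ S, ∃ p : G.Walk r r', ∀ x ∈ p.support, x ∈ S)
    {w₀ : V} (hw₀ : ∀ a : A, ∀ s ∈ S, a • s ≠ w₀) :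
    ∃ y : V, (∀ a : A, ∀ s ∈ S, a • s ≠ y) ∧
      (∀ r ∈ insert y S, ∀ r' ∈ insert y S, ∀ a : A, a • r = r' → r = r') ∧
      (∀ r ∈ insert y S, ∀ r' ∈ insert y S, ∃ p : G.Walk r r', ∀ x ∈ p.support, x ∈ insert y S) := by
  obtain ⟨s₀, hs₀⟩ := hne
  -- the saturation of `S`
  set T : Set V := {x | ∃ a : A, ∃ s ∈ S, a • s = x} with hT
  have hs₀T : s₀ ∈ T := ⟨1, s₀, hs₀, one_smul _ _⟩
  have hw₀T : w₀ ∉ T := fun ⟨a, s, hs, h⟩ => hw₀ a s hs h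
  obtain ⟨p⟩ := hc.preconnected s₀ w₀
  obtain ⟨d, -, hd1, hd2⟩ := p.exists_boundary_dart T hs₀T hw₀T
  obtain ⟨a, s, hs, hds⟩ := hd1
  -- pull the dart back to the representative `s`
  set y : V := a⁻¹ • d.toProd.2 with hy
  have hadj : G.Adj s y := by
    have h := (hact a⁻¹ d.toProd.1 d.toProd.2).2 d.adj
    rwa [← hds, inv_smul_smul] at h
  have hyT : ∀ b : A, ∀ s' ∈ S, b • s' ≠ y := by
    intro b s' hs' h
    apply hd2
    refine ⟨a * b, s', hs', ?_⟩
    rw [mul_smul, h, hy, smul_inv_smul]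
  refine ⟨y, hyT, ?_, ?_⟩
  · intro r hr r' hr' b hb
    rcases Finset.mem_insert.1 hr with rfl | hr
    · rcases Finset.mem_insert.1 hr' with rfl | hr'
      · rfl
      · -- `b • y = r' ∈ S` would put `y` in the saturation
        exact absurd (show b⁻¹ • r' = y by rw [← hb, inv_smul_smul]) (hyT b⁻¹ r' hr')
    · rcases Finset.mem_insert.1 hr' with rfl | hr'
      · exact absurd hb (hyT b r hr)
      · exact htrans r hr r' hr' b hb
  · -- walk-connectedness: through `s`
    have key : ∀ r ∈ S, ∃ q : G.Walk r y, ∀ x ∈ q.support, x ∈ insert y S := by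
      intro r hr
      obtain ⟨q, hq⟩ := hconn r hr s hs
      refine ⟨q.append (Walk.cons hadj Walk.nil), fun x hx => ?_⟩
      rw [Walk.support_append, List.mem_append] at hx
      rcases hx with hx | hx
      · exact Finset.mem_insert_of_mem (hq x hx)
      · rw [Walk.support_cons, Walk.support_nil, List.tail_cons, List.mem_singleton] at hx
        rw [hx]; exact Finset.mem_insert_self _ _
    intro r hr r' hr'
    rcases Finset.mem_insert.1 hr with rfl | hr
    · rcases Finset.mem_insert.1 hr' with rfl | hr'
      · exact ⟨Walk.nil, fun x hx => by rw [Walk.support_nil, List.mem_singleton] at hx; rw [hx]; exact Finset.mem_insert_self _ _⟩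
      · obtain ⟨q, hq⟩ := key r' hr'
        exact ⟨q.reverse, fun x hx => hq x (by rwa [Walk.support_reverse, List.mem_reverse] at hx)⟩
    · rcases Finset.mem_insert.1 hr' with rfl | hr'
      · exact key r hr
      · obtain ⟨q, hq⟩ := hconn r hr r' hr'
        exact ⟨q, fun x hx => Finset.mem_insert_of_mem (hq x hx)⟩

/-- **CONNECTED TRANSVERSALS EXIST**: a connected graph with an action by automorphisms having finitely many orbits (a finite covering family `reps₀`)
has a transversal — covering, pairwise inequivalent — any two members of which are joined by a walk through members (a connected fundamental domain).
[cite: BenjaminiSchramm1996, §2 (almost transitive graphs)] -/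
theorem exists_connected_transversal (hc : G.Connected) (reps₀ : Finset V) (hcover₀ : ∀ w : V, ∃ a : A, ∃ r ∈ reps₀, a • r = w) :
    ∃ reps : Finset V, (∀ w : V, ∃ a : A, ∃ r ∈ reps, a • r = w) ∧ (∀ r ∈ reps, ∀ r' ∈ reps, ∀ a : A, a • r = r' → r = r') ∧
      ∀ r ∈ reps, ∀ r' ∈ reps, ∃ p : G.Walk r r', ∀ x ∈ p.support, x ∈ reps := by
  -- `covered S` = the members of `reps₀` whose orbit meets `S`
  let covered : Finset V → Finset V := fun S => reps₀.filter fun r₀ => ∃ a : A, ∃ s ∈ S, a • s = r₀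
  have hcov_sub : ∀ S, covered S ⊆ reps₀ := fun S => Finset.filter_subset _ _
  -- induction: good sets covering at least `n` members of `reps₀`, or all of them
  have main : ∀ n : ℕ, ∃ S : Finset V, S.Nonempty ∧ (∀ r ∈ S, ∀ r' ∈ S, ∀ a : A, a • r = r' → r = r') ∧
      (∀ r ∈ S, ∀ r' ∈ S, ∃ p : G.Walk r r', ∀ x ∈ p.support, x ∈ S) ∧ (n ≤ (covered S).card ∨ covered S = reps₀) := by
    intro n
    induction n with
    | zero =>
      obtain ⟨v₀⟩ := hc.nonempty
      refine ⟨{v₀}, Finset.singleton_nonempty _, ?_, ?_, Or.inl (Nat.zero_le _)⟩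
      · intro r hr r' hr' a _
        rw [Finset.mem_singleton] at hr hr'
        rw [hr, hr']
      · intro r hr r' hr'
        rw [Finset.mem_singleton] at hr hr'
        subst hr; subst hr'
        exact ⟨Walk.nil, fun x hx => by rw [Walk.support_nil, List.mem_singleton] at hx; rw [hx]; exact Finset.mem_singleton_self _⟩
    | succ n ih =>
      obtain ⟨S, hne, htrans, hconn, hcard⟩ := ih
      by_cases hall : covered S = reps₀
      · exact ⟨S, hne, htrans, hconn, Or.inr hall⟩
      -- an uncovered member of `reps₀`
      have hex : ∃ w₀ ∈ reps₀, w₀ ∉ covered S := by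
        by_contra h
        push Not at h
        exact hall (Finset.Subset.antisymm (hcov_sub S) h)
      obtain ⟨w₀, hw₀, hw₀c⟩ := hex
      have hw₀' : ∀ a : A, ∀ s ∈ S, a • s ≠ w₀ := fun a s hs h =>
        hw₀c (Finset.mem_filter.2 ⟨hw₀, a, s, hs, h⟩)
      obtain ⟨y, hyT, htrans', hconn'⟩ := exists_insert_transversal hact hc hne htrans hconn hw₀'
      refine ⟨insert y S, Finset.insert_nonempty _ _, htrans', hconn', ?_⟩
      rcases hcard with hcard | hcard
      · left
        -- `y`'s orbit contains a member of `reps₀` that was not covered before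
        obtain ⟨b, r₁, hr₁, hbr₁⟩ := hcover₀ y
        have hr₁new : r₁ ∉ covered S := by
          intro h
          obtain ⟨-, a, s, hs, has⟩ := Finset.mem_filter.1 h
          exact hyT (b * a) s hs (by rw [mul_smul, has, hbr₁])
        have hr₁cov : r₁ ∈ covered (insert y S) :=
          Finset.mem_filter.2 ⟨hr₁, b⁻¹, y, Finset.mem_insert_self _ _, by rw [← hbr₁, inv_smul_smul]⟩
        have hsub : covered S ⊆ covered (insert y S) := by
          intro r hr
          obtain ⟨hr₀, a, s, hs, has⟩ := Finset.mem_filter.1 hr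
          exact Finset.mem_filter.2 ⟨hr₀, a, s, Finset.mem_insert_of_mem hs, has⟩
        have hssub : covered S ⊂ covered (insert y S) :=
          Finset.ssubset_iff_subset_ne.2 ⟨hsub, fun h => hr₁new (h ▸ hr₁cov)⟩
        have := Finset.card_lt_card hssub
        omega
      · exact absurd hcard hall
  obtain ⟨S, -, htrans, hconn, hcard⟩ := main reps₀.card
  have hall : covered S = reps₀ := by
    rcases hcard with hcard | hcard
    · exact Finset.eq_of_subset_of_card_le (hcov_sub S) hcard
    · exact hcard
  refine ⟨S, fun w => ?_, htrans, hconn⟩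
  obtain ⟨a, r₀, hr₀, rfl⟩ := hcover₀ w
  have h := hall.symm ▸ hr₀
  obtain ⟨-, b, s, hs, hbs⟩ := Finset.mem_filter.1 h
  exact ⟨a * b, s, hs, by rw [mul_smul, hbs]⟩

end Transversal

/-! ## §2 Independent edge values -/

section Indep

variable {reps : Finset V} (hcover : ∀ w : V, ∃ a : A, ∃ r ∈ reps, a • r = w)
  (htrans : ∀ r ∈ reps, ∀ r' ∈ reps, ∀ a : A, a • r = r' → r = r')
  (c : A →* Multiplicative (Site 2)) (hstab : ∀ (v : V), ∀ h ∈ MulAction.stabilizer A v, c h = 1)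
include htrans hstab

/-- **Along an edge the zero-offset chart moves by the chart value of a NEIGHBOUR OF A REPRESENTATIVE** (translate the edge back to the type of its
first endpoint). [folklore] -/
theorem exists_adj_ochart_sub (hact : IsActionByAut G A) {x y : V} (hxy : G.Adj x y) :
    ∃ r ∈ reps, ∃ n : V, G.Adj r n ∧ ochart hcover c y - ochart hcover c x = ochart hcover c n := by
  obtain ⟨b, r, hr, rfl⟩ := hcover x
  refine ⟨r, hr, b⁻¹ • y, ?_, ?_⟩
  · have h := (hact b⁻¹ (b • r) y).2 hxy
    rwa [inv_smul_smul] at h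
  · conv_lhs => rw [← smul_inv_smul b y]
    rw [ochart_smul hcover htrans c hstab, ochart_smul_of_mem hcover htrans c hstab b hr]
    abel

/-- **Walk induction**: if every chart value of a neighbour of a representative is parallel to `w` (`det2 · w = 0`), then so is every chart difference
along every walk. [folklore] -/
theorem det2_ochart_sub_eq_zero (hact : IsActionByAut G A) {w : Site 2}
    (hw : ∀ r ∈ reps, ∀ n : V, G.Adj r n → MaxArea.det2 (ochart hcover c n) w = 0) :
    ∀ {x y : V} (p : G.Walk x y), MaxArea.det2 (ochart hcover c y - ochart hcover c x) w = 0
  | _, _, Walk.nil => by rw [sub_self, MaxArea.det2_zero_left]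
  | x, y, Walk.cons (v := z) h p => by
    have ih := det2_ochart_sub_eq_zero hact hw p
    obtain ⟨r, hr, n, hn, he⟩ := exists_adj_ochart_sub hcover htrans c hstab hact h
    have e : ochart hcover c y - ochart hcover c x = (ochart hcover c y - ochart hcover c z) + (ochart hcover c z - ochart hcover c x) := by abel
    rw [e, MaxArea.det2_add_left, ih, he, hw r hr n hn, add_zero]

/-- **INDEPENDENT EDGE VALUES**: a character killing every stabiliser whose image has rank two takes INDEPENDENT values on two neighbours of
representatives (zero-offset chart values; `MaxArea.det2 ≠ 0`).  Otherwise all neighbour values are parallel to one of them (or all vanish), hence — by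
the walk induction along walks `r₀ → g • r₀` — so are all values `c g`, contradicting rank two. [cite: KozmaNitzan2024, §4 p. 16 (Lemma 8)] -/
theorem exists_indep_adj_values (hact : IsActionByAut G A) (hc : G.Connected)
    (hrank : ∃ a b : A, MaxArea.det2 (Multiplicative.toAdd (c a)) (Multiplicative.toAdd (c b)) ≠ 0) :
    ∃ r₁ ∈ reps, ∃ n₁ : V, G.Adj r₁ n₁ ∧ ∃ r₂ ∈ reps, ∃ n₂ : V, G.Adj r₂ n₂ ∧
      MaxArea.det2 (ochart hcover c n₁) (ochart hcover c n₂) ≠ 0 := by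
  obtain ⟨g, h, hgh⟩ := hrank
  -- every value `c a` is a chart difference along a walk from a representative
  have hval : ∀ (a : A) (w : Site 2), (∀ r ∈ reps, ∀ n : V, G.Adj r n → MaxArea.det2 (ochart hcover c n) w = 0) →
      MaxArea.det2 (Multiplicative.toAdd (c a)) w = 0 := by
    intro a w hw
    obtain ⟨v₀⟩ := hc.nonempty
    obtain ⟨b, r₀, hr₀, -⟩ := hcover v₀
    obtain ⟨p⟩ := hc.preconnected r₀ (a • r₀)
    have h0 := det2_ochart_sub_eq_zero hcover htrans c hstab hact hw p
    rwa [ochart_smul_of_mem hcover htrans c hstab a hr₀, ochart_of_mem hcover htrans c hstab hr₀, sub_zero] at h0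
  by_contra hno
  push Not at hno
  by_cases hall : ∀ r ∈ reps, ∀ n : V, G.Adj r n → ochart hcover c n = 0
  · -- all neighbour values vanish: every `c a` is parallel to everything
    have h1 : MaxArea.det2 (Multiplicative.toAdd (c g)) (Multiplicative.toAdd (c h)) = 0 :=
      hval g _ fun r hr n hn => by rw [hall r hr n hn, MaxArea.det2_zero_left]
    exact hgh h1
  · push Not at hall
    obtain ⟨r₀, hr₀, n₀, hn₀, hne⟩ := hall
    have hpar : ∀ r ∈ reps, ∀ n : V, G.Adj r n → MaxArea.det2 (ochart hcover c n) (ochart hcover c n₀) = 0 :=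
      fun r hr n hn => hno r hr n hn r₀ hr₀ n₀ hn₀
    have hg := hval g _ hpar
    have hh := hval h _ hpar
    exact hgh (CayleyScaled.det2_eq_zero_of_parallel hne hg hh)

end Indep

end AutChart

end Summit.CriticalPhenomena.PercolationContinuityZ3.Theorems.Transplant

end
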